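import Literature.MathematicalPhysics.QuantumFieldTheory.Balaban1983to89.Node00.CarriersB12Chart
import Literature.MathematicalPhysics.QuantumFieldTheory.Balaban1983to89.B12QPrime348
import Literature.MathematicalPhysics.QuantumFieldTheory.Balaban1983to89.B12Ineq332

/-!
# NODE 00 (YM-PLAN Track A) — STAGE 3′(X.B12) COMPANION, MODULE E: THE COARSE DATUM `B` OF (3.30) AND THE CLASS (3.31) PRESENTED AT NODE 00's OBJECTS —
# `A331Of` (the class (3.31) DEFINED: `𝔤ᶜ`-valued, `|𝐀|, |∇^η𝐀|, ‖𝐀‖_{1,β} < α₂` «on □₀»), `DatumB12Pres` (the two residual letters of (3.30): `h = L⁻¹𝐇_{k+1}(□₀, (1/i) log V(𝐔))`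
# and the linear averaging `Q`), `scrA = Λ(𝐀|□₀, h|□₀)` (lit r20's `B12QPrime348.lam330` BY NAME), `fldB = Q(ηA)`, THE REFINEMENT `ChartB12Run.withDatum` OF MODULE D's
# CHARTED RUN (`rfl` faces), AND WHAT THE PRESENTATION GIVES: `0 ∈ (3.31)` from «all the restrictions», «take 𝐀 = 0» ⇒ `B = Q(L⁻¹η𝐇_{k+1}·1_{□₀})`, (3.32)₁ at the
# objects (r20's `B12Ineq332.ineq332_sup_bond` BY NAME), `|B| ≤ ‖Q‖·η·2(α₂ + α′)`, the two datum-size laws of `ChartB12Laws` DERIVED (hence module D's chart laws at a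
# presented run from its datum-free laws, `chartB12Laws_withDatum`), and (3.48) «B = Q(L⁻¹η𝐇_{k+1}) + Q′» at the objects (r20's `eq348_lam330` BY NAME)

NODE 00 COMPANION MODULE (seat `pub-ymgap-node00-def-B12` g5, 2026-08-27; HUMAN RULING D-0062; director-ym R141 (A); module D's header «WHAT STAYS RESIDUAL … the coarse datum
`fldB` of (3.30), the class (3.31)»; dag-ref-C READ-151 READER NOTE (R-B12-ev) «a N09 count line over a charted run must display `ev`, `lin`, `fldB` read from print»).
APPEND-ONLY GROWTH (D-0064): a NEW importing module; nothing landed is edited; everything it reads is CONSUMED BY NAME — module D (`ChartB12Run`, `ChartB12Laws`, `toResid`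
and its faces; `Node00/CarriersB12Chart`), module A (`B12Provisos`; `Node00/Record12CarriersB12Package`), module 0 (`B12Package`), g32 (`IdxB12`, `ResidB12Run`;
`Node00/CarriersB12`), def-T (`Sect2.regionOfSet`; `Node00/Sect2FrameOfRecord`), pub-balaban (`B12RegularSpaces111.grad ∕ Region ∕ space`, `suModel`, `Setup.Site.tdist`),
lit-balaban r20 (`B12Membership313II.newPot`, `B12QPrime348.lam330 ∕ small330 ∕ qPrime ∕ newPot_zero_left ∕ eq348_lam330`, `B12Ineq332.ineq332_sup_bond`).

PRINT.  [I] = Bałaban, *Renormalization group approach to lattice gauge field theories. I*, CMP **109** (1987), §3 pp. 275–279 (held text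
`paper:balaban1987-cmp109-rg-i-small-field`, journal page = PDF page + 248); [12] = Bałaban, *Averaging operations for lattice gauge theories*, CMP **98** (1985) ([I]'s
reference [12], p. 299); [15] = Bałaban, *The variational problem …*, CMP **102** (1985).  p. 275: *«The function 𝐇_k^u and the averaging operations Q_j in the definition of
B_□ depend on U_{k+1}»*; (3.26) *«we introduce the same generalized axial gauge for the configuration M˙(𝐔). This is achieved by a gauge transformation v»*; (3.27) *«We make the
next gauge transformation u_{k+1} changing the axial gauge into Landau gauge for the configuration U_{k+1}(□₀, V), hence U_{k+1}(□₀, V)^{u_{k+1}} = exp(iL⁻¹η𝐇_{k+1}(□₀,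
(1/i) log V)), |𝐇_{k+1}(□₀, (1/i) log V)|, |∇^{L⁻¹η}𝐇_{k+1}(…)|, ‖𝐇_{k+1}(…)‖_{1,β} < B₃O(1)Mα₀ on □̃⁴, for 0 ≤ β ≤ β₀ < 1»*.  p. 276: *«it is important to understand
properties of the expression obtained from (3.28) by replacing (tζ̃_□ + t_□ζ_□)𝐇_k(B′) by a 𝔤ᶜ-valued variable 𝐀. Let us denote
A = (1/iη) log [exp iη𝐀 · exp iL⁻¹η𝐇_{k+1}(□₀, (1/i) log V)], B = Q(ηA) on □₀. (3.30) … The function B above is defined on the set of bonds determining U_j(□₀) … Now we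
define a class of functions 𝐀. We assume that 𝐀 is regular and satisfies the bounds |𝐀|, |∇^η𝐀|, ‖𝐀‖_{1,β} < α₂ on □₀, (3.31) for 0 ≤ β ≤ β₀ < 1. … We have similar
bounds for the function 𝐇_{k+1}(□₀, (1/i) log V), with α₂ replaced by B₃O(1)Mα₀, and □₀ by □̃⁴, see (3.27).»*  p. 277: *«The assumption (3.31) implies that A satisfies
|A|, |∇^ηA|, ‖A‖_{1,β} < 2(α₂ + B₃O(1)Mα₀) on □̃⁴. (3.32) … By the definition of B and by the inequalities (3.32) we have |B| < O(1)L^jη … At first let us take 𝐀 = 0. We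
have U_j(□₀, exp iτQ(L⁻¹η𝐇_{k+1})) = … (3.37)»*; p. 279 (3.48): *«B = Q(ηA) = Q(L⁻¹η𝐇_{k+1}) + ∫₀¹ dt₁ … = Q(L⁻¹η𝐇_{k+1}) + Q′»*.  The Hölder seminorm is [B5]'s (1.109)
p. 35: *«‖A‖_α = max_μ sup_{x,x′ : |x−x′| ≤ 1} |x − x′|^{−α}|A_μ(x) − A_μ(x′)|, ‖A‖_{1,α} = ‖∇A‖_α»* (tree `LatticeNorms` header), the distance being the `ℓ¹` one of the
`η`-lattice ([B6] p. 223; `Setup.Site.tdist` counts lattice steps, so `|x − x′| = η·tdist x x′`); `Q` is the LINEAR averaging (14) p. 19 of [12] (= (1.8) of [B5]; tree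
`B7Eq14LinearAverage.linAvg` on `ℤᵈ`).

WHAT IS DEFINED.
§1 `IdxB12.regionT i n` — «on □̃ⁿ» as a region of record (def-T's `Sect2.regionOfSet` of g32's `boxT n`: the bonds with both endpoints in `□̃ⁿ`, the derivative triples
   `(x, μ, ν)` of `□̃ⁿ`; `□₀ = regionT 5`, `□̃⁴ = regionT 4`, g32's `Y = regionY = regionT 3` by `rfl`); `IdxB12.onBox0 i F` — a bond function «defined on □₀» carried as the
   total function extended by `0` (the lineage's located reading, as g32's `|B′|`); **`A331Of N i α₂ β₀`** — THE CLASS (3.31) AT THE OBJECTS, a DEFINED set of total bond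
   functions `𝐀 : PBond P 0 → M_N(ℂ)`: `𝔤ᶜ`-valued on the bonds of `□₀` (p. 276 «a 𝔤ᶜ-valued variable 𝐀»; `(suModel N).gc = 𝔰𝔩(N, ℂ)`), `|𝐀(b)| < α₂` on the bonds of
   `□₀`, `|(∇^η_μ𝐀_ν)(x)| < α₂` on the derivative triples of `□₀` (the idiom of (1.14)(iii) of record, `B12RegularSpaces111.grad` at the spacing `η = idx.η`), and the
   Hölder member `‖𝐀‖_{1,β} < α₂` for every `0 ≤ β ≤ β₀`: for derivative triples `(x, μ, ν)`, `(x′, μ, ν)` of `□₀` with `0 < η·tdist x x′ ≤ 1`,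
   `|(∇^η_μ𝐀_ν)(x) − (∇^η_μ𝐀_ν)(x′)| < α₂·(η·tdist x x′)^β` (the sup form `< α₂` of print read member-wise on the finite torus).
§2 `DatumB12Pres P N` — THE PRESENTATION of (3.30): the letter `hBox : (𝐔, 𝐉) ↦ h = L⁻¹𝐇_{k+1}(□₀, (1/i) log V(𝐔))` of (3.26)–(3.27) (RESIDUAL: [15] Sect. F's axial
   gauge `V(𝐔)` and the `(k+1)`-st Landau-gauge chart on `□₀` have no tree object at NODE 00's objects) and the linear averaging `Q` (a continuous linear map of the bond
   functions; presentation datum — the tree's `linAvg` lives on `ℤᵈ`); then DEFINITIONS: `scrA δ i (𝐔,𝐉) 𝐀 = Λ(𝐀|□₀, h(𝐔)|□₀)` bondwise, `Λ = lam330 η` = r20's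
   `(1/iη) log [exp iη· · exp iη·]` BY NAME — print's `A` of (3.30) on `□₀`, `0` off `□₀` (`scrA_apply_of_mem ∕ _of_not_mem`); `fldB δ i (𝐔,𝐉) 𝐀 = Q(η·scrA)` — print's
   `B = Q(ηA)`.
§3 `ChartB12Run.withDatum χ δ` — module D's charted run with its two residual data fields PRESENTED: `fldB := δ.fldB χ.idx`, `A331 := A331Of N χ.idx χ.α₂ χ.β₀`
   (everything else unchanged; `rfl` faces), so that EVERY name of modules D ∕ C ∕ A ∕ 0 and g32 applies to `χ.withDatum δ` and to `(χ.withDatum δ).toResid`;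
   `dat_withDatum : 𝔄 = H_{1,j}(Q(ηA))`.
§4 WHAT THE PRESENTATION GIVES (theorems; elementary, from the cited tree lemmas BY NAME): `zero_mem_A331Of` (`0 ∈ (3.31)` iff-free from `0 < α₂`) and
   `zero_mem_A331_withDatum_of_restrictions` — module A's displayed proviso `B12Provisos.zero_mem` is a THEOREM at a presented layer, since «all the restrictions»
   (`B12Sec2to5.Lemma4Restrictions`) carry `0 < α₂`; `provisos_withDatum_of` (the provisos of a presented layer = package + restrictions); `scrA_zero ∕ fldB_zero` — print's
   «At first let us take 𝐀 = 0»: `A = h` on `□₀`, `B = Q(η·h·1_{□₀}) = Q(L⁻¹η𝐇_{k+1}(□₀, ·))`, the datum of (3.37) (r20's `newPot_zero_left`, under `η|h(b)| ≤ 1/4` on the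
   bonds of `□₀`); `norm_scrA_apply_lt_of_mem` — (3.32), first member, at the objects: `|𝐀(b)| < α₂`, `|h(b)| < α′`, `η(α₂ + α′) ≤ 1/8` ⇒ `|A(b)| < 2(α₂ + α′)` (r20's
   `ineq332_sup_bond`); `norm_scrA_le`, `norm_fldB_le : |B| ≤ ‖Q‖·(η·2(α₂ + α′))` (p. 277 «|B| < O(1)L^jη», kernel form: operator norm × scale × (3.32)); `norm_dat_withDatum_le`;
   **`dat_lt_withDatum`, `dat_lin_lt_withDatum`** — the two datum-size fields `dat_lt`, `dat_lin_lt` of module D's `ChartB12Laws` for `χ.withDatum δ`, DERIVED from a displayed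
   (3.27)-type law `|h(𝐔)(b)| < α′` for `(𝐔, 𝐉)` in the (3.40)-space of record and `b` a bond of `□₀`, `0 < η`, `η(α₂ + α′) ≤ 1/8` and the constant arithmetic
   `‖H_{1,j}‖·‖Q‖·η·2(α₂ + α′) (+ ‖H_{1,j}‖·α₃) < a`; `fldB_eq348` — (3.48) at the objects: `B = Q(η·h·1_{□₀}) + Q′(𝐀|□₀)` with r20's `qPrime`, for `𝐀|□₀` in r20's smallness
   set `small330 η (h·1_{□₀})` (r20's `eq348_lam330`; the regularity of `Q` is automatic for a continuous linear map); **`chartB12Laws_withDatum`** — module D's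
   `ChartB12Laws` at `χ.withDatum δ` BUILT from the run's thirteen datum-free laws (regime, `T`-laws, presentation domination, `𝔤ᶜ`-valuedness, (3.37)∕(3.45)∕(3.50)
   arithmetic — hypotheses, stated for `χ`) and the two derived datum sizes, so that module D's `toFundamental ∕ leaf_of_chart ∕ package_of_chart` apply to the
   presented run BY NAME; `provisos_of_chart_withDatum` — module D's `provisos_of_chart` with its `0 ∈ (3.31)` horn discharged.

LOCATED READINGS (said, not adjudicated).  (R-E1) «𝐀 defined on □₀», «A … on □₀»: total bond functions on `T_ε`, restricted to the bonds of `□₀` by zero extension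
(`onBox0`) before entering `Λ`; `Λ(0, 0) = 0` makes `A = 0` off `□₀`.  (R-E2) «B is defined on the set of bonds determining U_j(□₀)»: `B = Q(ηA)` is a bond function on
`T_ε` (g32's carrier `CfgB = PBond P 0 → M_N(ℂ)`); which bonds `Q` charges is a property of the presentation datum `Q`, not modelled.  (R-E3) the size law displayed for `h` in
`dat_lt_withDatum` is on the bonds of `□₀ = □̃⁵`, where `B` reads `A`; print's (3.27) is stated «on □̃⁴» (and p. 277 derives «|B| < O(1)L^jη» from (3.32) on `□̃⁴`) — the
display is the hypothesis the kernel bound needs, with `α′` free (print: `B₃O(1)Mα₀`).  (R-E4) (3.31)'s sup-norm members are read bond- ∕ triple-wise (`<` at each index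
of the finite region, equivalent to the strict sup bound on a nonempty finite set); the Hölder pairs are the derivative triples of `□₀` with equal `(μ, ν)` at `ℓ¹` torus
distance `0 < η·tdist ≤ 1`.

HONEST FRAMING (binding).  OBJECTS + kernel bookkeeping.  The residual letters `h(𝐔)` and `Q` are DATA with no construction here; the (3.27)∕(3.28) bounds, the chart
laws of module D other than the two datum sizes, the letters' analyticity and everything of [15] stay DISPLAYED hypotheses of their consumers; nothing of [I] ∕ [12] ∕
[15] is asserted; the theorems of §4 are elementary consequences of the cited tree lemmas (norm algebra).  N09 is NOT discharged by this file; R4's instance count is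
untouched; count-neutral.  One finite T⁴ programme at fixed ε, Bałaban as printed — NOT continuum ∕ ℝ⁴ ∕ infinite volume ∕ OS ∕ mass gap ∕ Clay.  No `sorry`, no
`axiom`, no `opaque`, no `instance`, no `notation`.
-/

noncomputable section

namespace Literature.MathematicalPhysics.QuantumFieldTheory.Balaban1983to89.Node00

open B12RegularSpaces111 (Region space grad)
open B12RegularSpaces111SpecialUnitary (suModel)
open B12Membership313II (newPot)
open B12QPrime348 (lam330 small330 qPrime newPot_zero_left eq348_lam330)
open B12Ineq332 (ineq332_sup_bond)
open B11Eq174Chart (Regime)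
open scoped Matrix.Norms.L2Operator

/-! ## §1. «on □̃ⁿ» as a region of record; «defined on □₀»; the class (3.31) at the objects -/

section ClassA331

variable {P : Params} {N M : ℕ}

namespace IdxB12

/-- **«on □̃ⁿ» as a region of record**: the bonds with both endpoints in `□̃ⁿ` and the derivative triples `(x, μ, ν)` of `□̃ⁿ` (def-T's `Sect2.regionOfSet` of `boxT n`);
`□₀ = regionT 5`, `□̃⁴ = regionT 4`, `Y = □̃³ = regionT 3`. [cite: Balaban1987RG1, p.273 («□₀ = □̃⁵»), (3.27) p.275 («on □̃⁴»), (3.31) p.276 («on □₀»)] -/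
def regionT (i : IdxB12 P M) (n : ℕ) : Region P 0 :=
  Sect2.regionOfSet P (i.boxT n)

/-- A bond of `□̃ⁿ` has both its endpoints in `□̃ⁿ`. [cite: Balaban1987RG1, (3.31) p.276 («on □₀») (bookkeeping)] -/
theorem mem_regionT_bonds_iff (i : IdxB12 P M) (n : ℕ) (b : PBond P 0) :
    b ∈ (i.regionT n).bonds ↔ b.src ∈ i.boxT n ∧ b.tgt ∈ i.boxT n :=
  Iff.rfl

/-- **A bond function «defined on □₀»**, carried as the total bond function extended by `0` off the bonds of `□₀` (the lineage's located reading (R-E1)).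
[cite: Balaban1987RG1, (3.30)–(3.31) p.276 («on □₀», «𝐀 defined on □₀»)] -/
def onBox0 (i : IdxB12 P M) (F : PBond P 0 → MatA N) : PBond P 0 → MatA N :=
  (i.regionT 5).bonds.indicator F

/-- On a bond of `□₀` the restricted function is the function. [cite: Balaban1987RG1, (3.31) p.276 (bookkeeping)] -/
theorem onBox0_apply_of_mem (i : IdxB12 P M) (F : PBond P 0 → MatA N) {b : PBond P 0} (hb : b ∈ (i.regionT 5).bonds) :
    i.onBox0 F b = F b := by
  simp [onBox0, hb]

/-- Off the bonds of `□₀` the restricted function vanishes. [cite: Balaban1987RG1, (3.31) p.276 (bookkeeping)] -/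
theorem onBox0_apply_of_not_mem (i : IdxB12 P M) (F : PBond P 0 → MatA N) {b : PBond P 0} (hb : b ∉ (i.regionT 5).bonds) :
    i.onBox0 F b = 0 := by
  simp [onBox0, hb]

/-- Restricting the zero function gives the zero function. [cite: Balaban1987RG1, p.277 («At first let us take 𝐀 = 0») (bookkeeping)] -/
@[simp] theorem onBox0_zero (i : IdxB12 P M) : i.onBox0 (0 : PBond P 0 → MatA N) = 0 := by
  funext b
  simp [onBox0]

/-- The restricted function is bounded where the function is: `|F·1_{□₀}(b)| ≤ |F(b)|`. [cite: Balaban1987RG1, (3.31) p.276 (bookkeeping)] -/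
theorem norm_onBox0_apply_le (i : IdxB12 P M) (F : PBond P 0 → MatA N) (b : PBond P 0) : ‖i.onBox0 F b‖ ≤ ‖F b‖ := by
  by_cases hb : b ∈ (i.regionT 5).bonds
  · rw [onBox0_apply_of_mem i F hb]
  · rw [onBox0_apply_of_not_mem i F hb, norm_zero]
    exact norm_nonneg (F b)

end IdxB12

/-- g32's region `Y = □̃³` of the residual layer IS `regionT 3` of its index. [cite: Balaban1987RG1, (3.37) p.277 («on □̃³») (bookkeeping)] -/
theorem ResidB12Run.regionY_eq_regionT (lam : ResidB12Run P N M) : lam.regionY = lam.idx.regionT 3 := rfl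

/-- **THE CLASS (3.31) AT NODE 00's OBJECTS** — *«a 𝔤ᶜ-valued variable 𝐀 … We assume that 𝐀 is regular and satisfies the bounds |𝐀|, |∇^η𝐀|, ‖𝐀‖_{1,β} < α₂ on □₀,
(3.31) for 0 ≤ β ≤ β₀ < 1»*: the set of total bond functions `𝐀 : PBond P 0 → M_N(ℂ)` which on `□₀ = □̃⁵` of the instance `i` are `𝔤ᶜ = 𝔰𝔩(N, ℂ)`-valued (bonds of `□₀`),
have `|𝐀(b)| < α₂` (bonds of `□₀`), `|(∇^η_μ𝐀_ν)(x)| < α₂` (derivative triples of `□₀`; `∇^η` = `B12RegularSpaces111.grad` at `η = i.η`), and Hölder quotients of `∇^η𝐀`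
([B5] (1.109): `‖𝐀‖_{1,β} = ‖∇𝐀‖_β`) `< α₂` for every `0 ≤ β ≤ β₀`: `|(∇^η_μ𝐀_ν)(x) − (∇^η_μ𝐀_ν)(x′)| < α₂·(η·tdist x x′)^β` for triples of `□₀` with the same `(μ, ν)` at
`ℓ¹` distance `0 < η·tdist x x′ ≤ 1` (located readings (R-E1), (R-E4)).
[cite: Balaban1987RG1, (3.31) p.276] [cite: Balaban1984PropagatorsI, (1.109) p.35] -/
def A331Of (N : ℕ) (i : IdxB12 P M) (α₂ β₀ : ℝ) : Set (PBond P 0 → MatA N) :=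
  {A | (∀ b ∈ (i.regionT 5).bonds, A b ∈ (suModel N).gc) ∧
    (∀ b ∈ (i.regionT 5).bonds, ‖A b‖ < α₂) ∧
    (∀ q ∈ (i.regionT 5).dpairs, ‖grad i.η q.2.1 (fun y => A ⟨y, q.2.2⟩) q.1‖ < α₂) ∧
    (∀ β : ℝ, 0 ≤ β → β ≤ β₀ → ∀ q ∈ (i.regionT 5).dpairs, ∀ q' ∈ (i.regionT 5).dpairs, q.2 = q'.2 →
      0 < i.η * (Site.tdist q.1 q'.1 : ℝ) → i.η * (Site.tdist q.1 q'.1 : ℝ) ≤ 1 →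
        ‖grad i.η q.2.1 (fun y => A ⟨y, q.2.2⟩) q.1 - grad i.η q'.2.1 (fun y => A ⟨y, q'.2.2⟩) q'.1‖ <
          α₂ * (i.η * (Site.tdist q.1 q'.1 : ℝ)) ^ β)}

/-- Membership in the class (3.31), unfolded. [cite: Balaban1987RG1, (3.31) p.276 (bookkeeping)] -/
theorem mem_A331Of_iff (i : IdxB12 P M) (α₂ β₀ : ℝ) (A : PBond P 0 → MatA N) :
    A ∈ A331Of N i α₂ β₀ ↔
      (∀ b ∈ (i.regionT 5).bonds, A b ∈ (suModel N).gc) ∧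
        (∀ b ∈ (i.regionT 5).bonds, ‖A b‖ < α₂) ∧
        (∀ q ∈ (i.regionT 5).dpairs, ‖grad i.η q.2.1 (fun y => A ⟨y, q.2.2⟩) q.1‖ < α₂) ∧
        (∀ β : ℝ, 0 ≤ β → β ≤ β₀ → ∀ q ∈ (i.regionT 5).dpairs, ∀ q' ∈ (i.regionT 5).dpairs, q.2 = q'.2 →
          0 < i.η * (Site.tdist q.1 q'.1 : ℝ) → i.η * (Site.tdist q.1 q'.1 : ℝ) ≤ 1 →
            ‖grad i.η q.2.1 (fun y => A ⟨y, q.2.2⟩) q.1 - grad i.η q'.2.1 (fun y => A ⟨y, q'.2.2⟩) q'.1‖ <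
              α₂ * (i.η * (Site.tdist q.1 q'.1 : ℝ)) ^ β) :=
  Iff.rfl

/-- The sup member of (3.31): `𝐀 ∈ (3.31) ⇒ |𝐀(b)| < α₂` on the bonds of `□₀`. [cite: Balaban1987RG1, (3.31) p.276] -/
theorem norm_apply_lt_of_mem_A331Of {i : IdxB12 P M} {α₂ β₀ : ℝ} {A : PBond P 0 → MatA N} (hA : A ∈ A331Of N i α₂ β₀)
    {b : PBond P 0} (hb : b ∈ (i.regionT 5).bonds) : ‖A b‖ < α₂ :=
  hA.2.1 b hb

/-- The `𝔤ᶜ` member of (3.31): `𝐀 ∈ (3.31) ⇒ 𝐀(b) ∈ 𝔤ᶜ` on the bonds of `□₀`. [cite: Balaban1987RG1, p.276 («a 𝔤ᶜ-valued variable 𝐀»)] -/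
theorem apply_mem_gc_of_mem_A331Of {i : IdxB12 P M} {α₂ β₀ : ℝ} {A : PBond P 0 → MatA N} (hA : A ∈ A331Of N i α₂ β₀)
    {b : PBond P 0} (hb : b ∈ (i.regionT 5).bonds) : A b ∈ (suModel N).gc :=
  hA.1 b hb

/-- **`0 ∈ (3.31)` whenever `0 < α₂`** (p. 277 *«At first let us take 𝐀 = 0»*): the zero field is `𝔤ᶜ`-valued, and all its norms, gradients and Hölder quotients vanish
(`(η·tdist x x′)^β > 0` on the admissible pairs). [cite: Balaban1987RG1, (3.31) p.276, p.277] -/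
theorem zero_mem_A331Of (i : IdxB12 P M) {α₂ : ℝ} (hα₂ : 0 < α₂) (β₀ : ℝ) : (0 : PBond P 0 → MatA N) ∈ A331Of N i α₂ β₀ := by
  refine ⟨fun b _ => by simp, fun b _ => by simpa using hα₂, fun q _ => by simpa [grad] using hα₂, ?_⟩
  intro β _ _ q _ q' _ _ ht0 _
  simp only [grad, Pi.zero_apply, sub_self, smul_zero, norm_zero]
  exact mul_pos hα₂ (Real.rpow_pos_of_pos ht0 β)

end ClassA331

/-! ## §2. The presentation of (3.30): the residual letters `h`, `Q`; `A = Λ(𝐀|□₀, h|□₀)` and `B = Q(ηA)` as definitions -/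

section Datum

variable (P : Params) (N : ℕ) {M : ℕ}

/-- **THE PRESENTATION OF THE COARSE DATUM (3.30)** — the two residual letters: `hBox : (𝐔, 𝐉) ↦ h = L⁻¹𝐇_{k+1}(□₀, (1/i) log V(𝐔))` ((3.26)–(3.27): the generalized axial
gauge `V(𝐔)` of [15] Sect. F and the `(k+1)`-st Landau-gauge chart on `□₀` — RESIDUAL, no tree object at NODE 00's objects) and the linear averaging `Q` of «B = Q(ηA)» read
as a continuous linear map of the bond functions on `T_ε` ((14) [12]; presentation datum). [cite: Balaban1987RG1, (3.26)–(3.27) p.275, (3.30) p.276]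
[cite: Balaban1985Averaging, (14) p.19] -/
structure DatumB12Pres where
  /-- `h(𝐔) = L⁻¹𝐇_{k+1}(□₀, (1/i) log V(𝐔))` of (3.26)–(3.27) (residual) -/
  hBox : FieldPair P 0 (MatA N)ˣ (MatA N) → PBond P 0 → MatA N
  /-- the linear averaging `Q` of «B = Q(ηA)» ((14) [12]) on the bond functions -/
  Q : (PBond P 0 → MatA N) →L[ℂ] (PBond P 0 → MatA N)

/-- The presentation type is inhabited (zero letters; bookkeeping only). [cite: Balaban1987RG1, (3.30) p.276 (bookkeeping)] -/
theorem nonempty_datumB12Pres : Nonempty (DatumB12Pres P N) :=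
  ⟨{ hBox := fun _ _ => 0, Q := 0 }⟩

namespace DatumB12Pres

variable {P N}
variable (δ : DatumB12Pres P N) (i : IdxB12 P M)

/-- **The function `A` of (3.30) «on □₀»**: `A = Λ(𝐀|□₀, h(𝐔)|□₀)` bondwise, `Λ(𝐀, h)(b) = (1/iη) log [exp iη𝐀(b) · exp iηh(b)]` = lit r20's `lam330 η` BY NAME (`η = i.η`),
the arguments restricted to `□₀` by zero extension (R-E1). [cite: Balaban1987RG1, (3.30) p.276] -/
def scrA (Φ : FieldPair P 0 (MatA N)ˣ (MatA N)) (A : PBond P 0 → MatA N) : PBond P 0 → MatA N :=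
  lam330 i.η (i.onBox0 (δ.hBox Φ)) (i.onBox0 A)

/-- **The coarse datum `B = Q(ηA)` of (3.30)** (the field `fldB` of module D's charted run, PRESENTED). [cite: Balaban1987RG1, (3.30) p.276] -/
def fldB (Φ : FieldPair P 0 (MatA N)ˣ (MatA N)) (A : PBond P 0 → MatA N) : PBond P 0 → MatA N :=
  δ.Q (((i.η : ℝ) : ℂ) • δ.scrA i Φ A)

/-- On a bond of `□₀`: `A(b) = Λ(𝐀(b), h(b))`. [cite: Balaban1987RG1, (3.30) p.276] -/
theorem scrA_apply_of_mem (Φ : FieldPair P 0 (MatA N)ˣ (MatA N)) (A : PBond P 0 → MatA N) {b : PBond P 0} (hb : b ∈ (i.regionT 5).bonds) :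
    δ.scrA i Φ A b = newPot i.η (A b) (δ.hBox Φ b) := by
  simp [scrA, i.onBox0_apply_of_mem _ hb]

/-- Off the bonds of `□₀`: `A(b) = Λ(0, 0) = 0`. [cite: Balaban1987RG1, (3.30) p.276 («on □₀»)] -/
theorem scrA_apply_of_not_mem (Φ : FieldPair P 0 (MatA N)ˣ (MatA N)) (A : PBond P 0 → MatA N) {b : PBond P 0} (hb : b ∉ (i.regionT 5).bonds) :
    δ.scrA i Φ A b = 0 := by
  simp [scrA, i.onBox0_apply_of_not_mem _ hb, newPot, B12Membership313II.bchLog_zero_zero]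

/-- `A` depends on `𝐀` only through `𝐀|□₀`. [cite: Balaban1987RG1, (3.30)–(3.31) p.276 («𝐀 defined on □₀») (bookkeeping)] -/
theorem scrA_onBox0 (Φ : FieldPair P 0 (MatA N)ˣ (MatA N)) (A : PBond P 0 → MatA N) : δ.scrA i Φ (i.onBox0 A) = δ.scrA i Φ A := by
  funext b
  by_cases hb : b ∈ (i.regionT 5).bonds
  · rw [δ.scrA_apply_of_mem i Φ _ hb, δ.scrA_apply_of_mem i Φ _ hb, i.onBox0_apply_of_mem A hb]
  · rw [δ.scrA_apply_of_not_mem i Φ _ hb, δ.scrA_apply_of_not_mem i Φ _ hb]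

/-- **«At first let us take 𝐀 = 0»**: `A|_{𝐀 = 0} = h·1_{□₀}` (`Λ(0, h) = h`, lit r20's `newPot_zero_left` BY NAME), for `η > 0` and `η|h(b)| ≤ 1/4` on the bonds of `□₀`.
[cite: Balaban1987RG1, p.277 with (3.37); (3.48) p.279 (first term)] -/
theorem scrA_zero (hη : 0 < i.η) (Φ : FieldPair P 0 (MatA N)ˣ (MatA N)) (hh : ∀ b ∈ (i.regionT 5).bonds, i.η * ‖δ.hBox Φ b‖ ≤ 1 / 4) :
    δ.scrA i Φ 0 = i.onBox0 (δ.hBox Φ) := by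
  funext b
  by_cases hb : b ∈ (i.regionT 5).bonds
  · rw [δ.scrA_apply_of_mem i Φ 0 hb, Pi.zero_apply, newPot_zero_left hη (hh b hb), i.onBox0_apply_of_mem _ hb]
  · rw [δ.scrA_apply_of_not_mem i Φ 0 hb, i.onBox0_apply_of_not_mem _ hb]

/-- **The datum at `𝐀 = 0` is `Q(η·h·1_{□₀}) = Q(L⁻¹η𝐇_{k+1}(□₀, (1/i) log V))`** — the datum of (3.37). [cite: Balaban1987RG1, (3.37) p.277; (3.48) p.279] -/
theorem fldB_zero (hη : 0 < i.η) (Φ : FieldPair P 0 (MatA N)ˣ (MatA N)) (hh : ∀ b ∈ (i.regionT 5).bonds, i.η * ‖δ.hBox Φ b‖ ≤ 1 / 4) :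
    δ.fldB i Φ 0 = δ.Q (((i.η : ℝ) : ℂ) • i.onBox0 (δ.hBox Φ)) := by
  simp only [fldB, δ.scrA_zero i hη Φ hh]

/-- **(3.32), first member, AT THE OBJECTS** — *«|A| < 2(α₂ + B₃O(1)Mα₀)»* at a bond of `□₀`: if `|𝐀(b)| < α₂` ((3.31)), `|h(b)| < α′` ((3.27): `α′ = B₃O(1)Mα₀`) and
`η(α₂ + α′) ≤ 1/8`, then `|A(b)| < 2(α₂ + α′)` (lit r20's `B12Ineq332.ineq332_sup_bond` BY NAME). [cite: Balaban1987RG1, (3.32) p.277] -/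
theorem norm_scrA_apply_lt_of_mem (hη : 0 < i.η) {α₂ α' : ℝ} (Φ : FieldPair P 0 (MatA N)ˣ (MatA N)) (A : PBond P 0 → MatA N) {b : PBond P 0}
    (hb : b ∈ (i.regionT 5).bonds) (hA : ‖A b‖ < α₂) (hh : ‖δ.hBox Φ b‖ < α') (hsmall : i.η * (α₂ + α') ≤ 1 / 8) :
    ‖δ.scrA i Φ A b‖ < 2 * (α₂ + α') := by
  rw [δ.scrA_apply_of_mem i Φ A hb]
  exact ineq332_sup_bond hη hA hh hsmall

/-- `|A| ≤ 2(α₂ + α′)` as a bound of the total bond function (off `□₀`, `A = 0`). [cite: Balaban1987RG1, (3.32) p.277] -/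
theorem norm_scrA_le (hη : 0 < i.η) {α₂ α' : ℝ} (h0 : 0 ≤ α₂ + α') (Φ : FieldPair P 0 (MatA N)ˣ (MatA N)) (A : PBond P 0 → MatA N)
    (hA : ∀ b ∈ (i.regionT 5).bonds, ‖A b‖ < α₂) (hh : ∀ b ∈ (i.regionT 5).bonds, ‖δ.hBox Φ b‖ < α') (hsmall : i.η * (α₂ + α') ≤ 1 / 8) :
    ‖δ.scrA i Φ A‖ ≤ 2 * (α₂ + α') := by
  refine (pi_norm_le_iff_of_nonneg (by positivity)).2 fun b => ?_
  by_cases hb : b ∈ (i.regionT 5).bonds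
  · exact (δ.norm_scrA_apply_lt_of_mem i hη Φ A hb (hA b hb) (hh b hb) hsmall).le
  · rw [δ.scrA_apply_of_not_mem i Φ A hb, norm_zero]
    positivity

/-- **`|B| ≤ ‖Q‖·η·2(α₂ + α′)`** — p. 277 *«By the definition of B and by the inequalities (3.32) we have |B| < O(1)L^jη»* in kernel form (operator norm of `Q` × the scale
`η` × the bound (3.32) of `A` on `□₀`). [cite: Balaban1987RG1, p.277 (after (3.34)); (3.30) p.276, (3.32) p.277] -/
theorem norm_fldB_le (hη : 0 < i.η) {α₂ α' : ℝ} (h0 : 0 ≤ α₂ + α') (Φ : FieldPair P 0 (MatA N)ˣ (MatA N)) (A : PBond P 0 → MatA N)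
    (hA : ∀ b ∈ (i.regionT 5).bonds, ‖A b‖ < α₂) (hh : ∀ b ∈ (i.regionT 5).bonds, ‖δ.hBox Φ b‖ < α') (hsmall : i.η * (α₂ + α') ≤ 1 / 8) :
    ‖δ.fldB i Φ A‖ ≤ ‖δ.Q‖ * (i.η * (2 * (α₂ + α'))) := by
  have h1 : ‖δ.fldB i Φ A‖ ≤ ‖δ.Q‖ * ‖((i.η : ℝ) : ℂ) • δ.scrA i Φ A‖ := δ.Q.le_opNorm _
  have h2 : ‖((i.η : ℝ) : ℂ) • δ.scrA i Φ A‖ = i.η * ‖δ.scrA i Φ A‖ := by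
    rw [norm_smul, Complex.norm_real, Real.norm_of_nonneg hη.le]
  have h3 := δ.norm_scrA_le i hη h0 Φ A hA hh hsmall
  rw [h2] at h1
  calc ‖δ.fldB i Φ A‖ ≤ ‖δ.Q‖ * (i.η * ‖δ.scrA i Φ A‖) := h1
    _ ≤ ‖δ.Q‖ * (i.η * (2 * (α₂ + α'))) := by gcongr

/-- **(3.48) AT THE OBJECTS** — *«B = Q(ηA) = Q(L⁻¹η𝐇_{k+1}) + Q′»*: for `η > 0` and `𝐀|□₀` in lit r20's smallness set `small330 η (h·1_{□₀})`,
`B = Q(η·h·1_{□₀}) + Q′(𝐀|□₀)` with r20's `Q′ = qPrime` (their `eq348_lam330` BY NAME; `Q` is `C¹` as a continuous linear map). [cite: Balaban1987RG1, (3.48) p.279] -/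
theorem fldB_eq348 (hη : 0 < i.η) (Φ : FieldPair P 0 (MatA N)ˣ (MatA N)) (A : PBond P 0 → MatA N)
    (hA : i.onBox0 A ∈ small330 i.η (i.onBox0 (δ.hBox Φ))) :
    δ.fldB i Φ A = δ.Q (((i.η : ℝ) : ℂ) • i.onBox0 (δ.hBox Φ)) + qPrime δ.Q (lam330 i.η (i.onBox0 (δ.hBox Φ))) i.η (i.onBox0 A) := by
  have hQ : ContDiffOn ℝ 1 (fun x : PBond P 0 → MatA N => δ.Q x) Set.univ := (δ.Q.restrictScalars ℝ).contDiff.contDiffOn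
  have h := eq348_lam330 (F := PBond P 0 → MatA N) isOpen_univ hQ hη hA (fun _ _ => Set.mem_univ _)
  simp only [fldB, scrA, Complex.coe_smul]
  exact h

end DatumB12Pres

end Datum

/-! ## §3. Module D's charted run with the datum and the class PRESENTED; what the presentation gives -/

section WithDatum

variable {P : Params} {N M : ℕ} {𝒴 𝒵 : Type} [NormedAddCommGroup 𝒴] [NormedSpace ℂ 𝒴] [NormedAddCommGroup 𝒵] [NormedSpace ℂ 𝒵]

namespace ChartB12Run

variable (χ : ChartB12Run P N M 𝒴 𝒵) (δ : DatumB12Pres P N)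

/-- **THE CHARTED RUN WITH ITS DATUM AND CLASS PRESENTED**: module D's `ChartB12Run` with `fldB := Q(η·Λ(𝐀|□₀, h|□₀))` ((3.30) on the presentation `δ`) and
`A331 :=` the class (3.31) DEFINED at the run's own index and constants (`A331Of N idx α₂ β₀`); every other field unchanged.
[cite: Balaban1987RG1, (3.30)–(3.31) p.276] -/
def withDatum : ChartB12Run P N M 𝒴 𝒵 :=
  { χ with fldB := δ.fldB χ.idx, A331 := A331Of N χ.idx χ.α₂ χ.β₀ }

/-- The presented run's coarse datum IS `Q(ηA)` of (3.30). [cite: Balaban1987RG1, (3.30) p.276 (bookkeeping)] -/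
@[simp] theorem withDatum_fldB : (χ.withDatum δ).fldB = δ.fldB χ.idx := rfl

/-- The presented run's class IS (3.31) at the run's index and constants. [cite: Balaban1987RG1, (3.31) p.276 (bookkeeping)] -/
@[simp] theorem withDatum_A331 : (χ.withDatum δ).A331 = A331Of N χ.idx χ.α₂ χ.β₀ := rfl

/-- The instance index is unchanged. [cite: Balaban1987RG1, Lemma 4 p.280 (bookkeeping)] -/
@[simp] theorem withDatum_idx : (χ.withDatum δ).idx = χ.idx := rfl

/-- [15]'s `𝒢` is unchanged. [cite: Balaban1985Variational, (174) p.305 (bookkeeping)] -/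
@[simp] theorem withDatum_𝒢 : (χ.withDatum δ).𝒢 = χ.𝒢 := rfl

/-- [15]'s `W` is unchanged. [cite: Balaban1985Variational, (174) p.305 (bookkeeping)] -/
@[simp] theorem withDatum_W : (χ.withDatum δ).W = χ.W := rfl

/-- [15]'s `T` is unchanged. [cite: Balaban1985Variational, (175) p.305 (bookkeeping)] -/
@[simp] theorem withDatum_T : (χ.withDatum δ).T = χ.T := rfl

/-- The radius `ε₄` is unchanged. [cite: Balaban1985Variational, (174) p.305 (bookkeeping)] -/
@[simp] theorem withDatum_ε₄ : (χ.withDatum δ).ε₄ = χ.ε₄ := rfl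

/-- The regime radius `a` is unchanged. [cite: Balaban1985Variational, Prop. 6 p.295 (bookkeeping)] -/
@[simp] theorem withDatum_a : (χ.withDatum δ).a = χ.a := rfl

/-- The presentation `ev` is unchanged. [cite: Balaban1987RG1, (3.37) p.277 (bookkeeping)] -/
@[simp] theorem withDatum_ev : (χ.withDatum δ).ev = χ.ev := rfl

/-- The linear datum map `H_{1,j}` is unchanged. [cite: Balaban1987RG1, p.279 («H_{1,j}B») (bookkeeping)] -/
@[simp] theorem withDatum_lin : (χ.withDatum δ).lin = χ.lin := rfl

/-- The constant `α₂` is unchanged. [cite: Balaban1987RG1, (3.31) p.276 (bookkeeping)] -/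
@[simp] theorem withDatum_α₂ : (χ.withDatum δ).α₂ = χ.α₂ := rfl

/-- The constant `α₃` is unchanged. [cite: Balaban1987RG1, Lemma 4 p.280 (bookkeeping)] -/
@[simp] theorem withDatum_α₃ : (χ.withDatum δ).α₃ = χ.α₃ := rfl

/-- The constant `β₀` is unchanged. [cite: Balaban1987RG1, (3.31) p.276 (bookkeeping)] -/
@[simp] theorem withDatum_β₀ : (χ.withDatum δ).β₀ = χ.β₀ := rfl

/-- The Lemma-4 constants of the presented run are the run's. [cite: Balaban1987RG1, Lemma 4 p.280 (bookkeeping)] -/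
theorem withDatum_consts : (χ.withDatum δ).toResid.consts = χ.toResid.consts := rfl

/-- The presented residual layer's class (3.31) is the DEFINED one. [cite: Balaban1987RG1, (3.31) p.276 (bookkeeping)] -/
@[simp] theorem toResid_withDatum_A331 : (χ.withDatum δ).toResid.A331 = A331Of N χ.idx χ.α₂ χ.β₀ := rfl

/-- The presented residual layer's index is the run's. [cite: Balaban1987RG1, Lemma 4 p.280 (bookkeeping)] -/
@[simp] theorem toResid_withDatum_idx : (χ.withDatum δ).toResid.idx = χ.idx := rfl

/-- **`𝔄(𝐔, 𝐀) = H_{1,j}Q(ηA)`** — the datum of the `j`-th chart at the presented run. [cite: Balaban1987RG1, (3.30) p.276, p.279 («𝐇_j(□₀, B) = H_{1,j}B − …»)] -/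
theorem dat_withDatum (Φ : FieldPair P 0 (MatA N)ˣ (MatA N)) (A : PBond P 0 → MatA N) :
    (χ.withDatum δ).dat Φ A = χ.lin (δ.fldB χ.idx Φ A) := rfl

/-- **Module A's proviso `zero_mem` is a THEOREM at a presented layer**: «all the restrictions» (`B12Sec2to5.Lemma4Restrictions`, which carry `0 < α₂`) give `0 ∈ (3.31)`.
[cite: Balaban1987RG1, (3.31) p.276, p.277 («At first let us take 𝐀 = 0»), §3 pp.276–280 («all the restrictions»)] -/
theorem zero_mem_A331_withDatum_of_restrictions (hR : B12Sec2to5.Lemma4Restrictions (χ.withDatum δ).toResid.consts) :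
    (0 : PBond P 0 → MatA N) ∈ (χ.withDatum δ).toResid.A331 :=
  zero_mem_A331Of χ.idx hR.2.2.1 χ.β₀

/-- **The provisos of a presented layer are its package and its restrictions** (the third display, `0 ∈ (3.31)`, follows). [cite: Balaban1987RG1, Lemma 4 (3.53) p.280; (3.31) p.276] -/
theorem provisos_withDatum_of {Rz : Sect2.Residual P (MatA N)} {cB : ℝ} (hpkg : Nonempty (B12Package Rz cB (χ.withDatum δ).toResid))
    (hR : B12Sec2to5.Lemma4Restrictions (χ.withDatum δ).toResid.consts) : B12Provisos Rz cB (χ.withDatum δ).toResid :=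
  ⟨hpkg, hR, χ.zero_mem_A331_withDatum_of_restrictions δ hR⟩

/-- **`‖𝔄(𝐔, 𝐀)‖ ≤ ‖H_{1,j}‖·‖Q‖·η·2(α₂ + α′)`** at the presented run, from (3.31)'s sup member on `□₀`, a (3.27)-type bound `|h(𝐔)(b)| < α′` on the bonds of `□₀` and
`η(α₂ + α′) ≤ 1/8`. [cite: Balaban1987RG1, p.277 («|B| < O(1)L^jη»), (3.27) p.275, (3.31)–(3.32) pp.276–277] -/
theorem norm_dat_withDatum_le (hη : 0 < χ.idx.η) {α' : ℝ} (h0 : 0 ≤ χ.α₂ + α') (Φ : FieldPair P 0 (MatA N)ˣ (MatA N)) (A : PBond P 0 → MatA N)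
    (hA : A ∈ A331Of N χ.idx χ.α₂ χ.β₀) (hh : ∀ b ∈ (χ.idx.regionT 5).bonds, ‖δ.hBox Φ b‖ < α') (hsmall : χ.idx.η * (χ.α₂ + α') ≤ 1 / 8) :
    ‖(χ.withDatum δ).dat Φ A‖ ≤ ‖χ.lin‖ * (‖δ.Q‖ * (χ.idx.η * (2 * (χ.α₂ + α')))) := by
  rw [dat_withDatum]
  have h1 : ‖χ.lin (δ.fldB χ.idx Φ A)‖ ≤ ‖χ.lin‖ * ‖δ.fldB χ.idx Φ A‖ := χ.lin.le_opNorm _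
  have h2 := δ.norm_fldB_le χ.idx hη h0 Φ A hA.2.1 hh hsmall
  exact h1.trans (mul_le_mul_of_nonneg_left h2 χ.lin.opNorm_nonneg)

/-- **THE DATUM-SIZE LAW `ChartB12Laws.dat_lt` OF MODULE D, DERIVED for the presented run** from the displayed (3.27)-type law `|h(𝐔)(b)| < α′` for `(𝐔, 𝐉)` in the
(3.40)-space of record and `b` a bond of `□₀` (located reading (R-E3)), `0 < η`, `η(α₂ + α′) ≤ 1/8` and the arithmetic `‖H_{1,j}‖·‖Q‖·η·2(α₂ + α′) < a`.
[cite: Balaban1987RG1, p.277 («|B| < O(1)L^jη»), (3.27) p.275, (3.30)–(3.32) pp.276–277, (3.40) p.278] -/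
theorem dat_lt_withDatum {Rz : Sect2.Residual P (MatA N)} {cB α' : ℝ} (hη : 0 < χ.idx.η) (h0 : 0 ≤ χ.α₂ + α')
    (hh : ∀ Φ : FieldPair P 0 (MatA N)ˣ (MatA N),
      Φ ∈ space (suModel N) (χ.toResid.frameBox Rz) (χ.toResid.csBox cB) ((1 + 2 * χ.toResid.consts.β) * χ.toResid.consts.α₀)
          ((1 + 2 * χ.toResid.consts.β) * χ.toResid.consts.α₁) χ.toResid.α₀ →
        ∀ b ∈ (χ.idx.regionT 5).bonds, ‖δ.hBox Φ b‖ < α')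
    (hsmall : χ.idx.η * (χ.α₂ + α') ≤ 1 / 8) (ha : ‖χ.lin‖ * (‖δ.Q‖ * (χ.idx.η * (2 * (χ.α₂ + α')))) < χ.a) :
    ∀ (Φ : FieldPair P 0 (MatA N)ˣ (MatA N)) (A : PBond P 0 → MatA N),
      Φ ∈ space (suModel N) ((χ.withDatum δ).toResid.frameBox Rz) ((χ.withDatum δ).toResid.csBox cB)
          ((1 + 2 * (χ.withDatum δ).toResid.consts.β) * (χ.withDatum δ).toResid.consts.α₀)
          ((1 + 2 * (χ.withDatum δ).toResid.consts.β) * (χ.withDatum δ).toResid.consts.α₁) (χ.withDatum δ).toResid.α₀ →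
        A ∈ (χ.withDatum δ).toResid.A331 → ‖(χ.withDatum δ).dat Φ A‖ < (χ.withDatum δ).a := by
  intro Φ A hΦ hA
  have hle := χ.norm_dat_withDatum_le δ hη h0 Φ A hA (hh Φ hΦ) hsmall
  exact lt_of_le_of_lt hle ha

/-- **THE DATUM-SIZE LAW `ChartB12Laws.dat_lin_lt` OF MODULE D, DERIVED for the presented run** — `‖τ𝔄 + H_{1,j}B′‖ < a` on the printed domain (`τ ∈ [0, 1]`, `|B′| < α₃`)
from the same displayed (3.27)-type law, `0 < η`, `η(α₂ + α′) ≤ 1/8` and the arithmetic `‖H_{1,j}‖·(‖Q‖·η·2(α₂ + α′) + α₃) < a`.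
[cite: Balaban1987RG1, p.277 («|B| < O(1)L^jη»), pp.279–280 («B′ with values in 𝔤ᶜ, |B′| < α₃»), (3.27) p.275, (3.30)–(3.32) pp.276–277] -/
theorem dat_lin_lt_withDatum {Rz : Sect2.Residual P (MatA N)} {cB α' : ℝ} (hη : 0 < χ.idx.η) (h0 : 0 ≤ χ.α₂ + α')
    (hh : ∀ Φ : FieldPair P 0 (MatA N)ˣ (MatA N),
      Φ ∈ space (suModel N) (χ.toResid.frameBox Rz) (χ.toResid.csBox cB) ((1 + 2 * χ.toResid.consts.β) * χ.toResid.consts.α₀)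
          ((1 + 2 * χ.toResid.consts.β) * χ.toResid.consts.α₁) χ.toResid.α₀ →
        ∀ b ∈ (χ.idx.regionT 5).bonds, ‖δ.hBox Φ b‖ < α')
    (hsmall : χ.idx.η * (χ.α₂ + α') ≤ 1 / 8) (ha : ‖χ.lin‖ * (‖δ.Q‖ * (χ.idx.η * (2 * (χ.α₂ + α'))) + χ.α₃) < χ.a) :
    ∀ (Φ : FieldPair P 0 (MatA N)ˣ (MatA N)) (A : PBond P 0 → MatA N) (τ : ℝ) (B' : PBond P 0 → MatA N),
      Φ ∈ space (suModel N) ((χ.withDatum δ).toResid.frameBox Rz) ((χ.withDatum δ).toResid.csBox cB)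
          ((1 + 2 * (χ.withDatum δ).toResid.consts.β) * (χ.withDatum δ).toResid.consts.α₀)
          ((1 + 2 * (χ.withDatum δ).toResid.consts.β) * (χ.withDatum δ).toResid.consts.α₁) (χ.withDatum δ).toResid.α₀ →
        A ∈ (χ.withDatum δ).toResid.A331 → 0 ≤ τ → τ ≤ 1 → ‖B'‖ < (χ.withDatum δ).toResid.consts.α₃ →
          ‖(τ : ℂ) • (χ.withDatum δ).dat Φ A + (χ.withDatum δ).lin B'‖ < (χ.withDatum δ).a := by
  intro Φ A τ B' hΦ hA hτ0 hτ1 hB'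
  have hB'' : ‖B'‖ < χ.α₃ := hB'
  set X : ℝ := ‖δ.Q‖ * (χ.idx.η * (2 * (χ.α₂ + α'))) with hX
  have hX0 : 0 ≤ X := by positivity
  have hdat : ‖(χ.withDatum δ).dat Φ A‖ ≤ ‖χ.lin‖ * X := χ.norm_dat_withDatum_le δ hη h0 Φ A hA (hh Φ hΦ) hsmall
  have hlin0 : 0 ≤ ‖χ.lin‖ := χ.lin.opNorm_nonneg
  have h1 : ‖(τ : ℂ) • (χ.withDatum δ).dat Φ A‖ ≤ ‖χ.lin‖ * X := by
    rw [norm_smul, Complex.norm_real, Real.norm_of_nonneg hτ0]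
    calc τ * ‖(χ.withDatum δ).dat Φ A‖ ≤ 1 * ‖(χ.withDatum δ).dat Φ A‖ := by gcongr
      _ = ‖(χ.withDatum δ).dat Φ A‖ := one_mul _
      _ ≤ ‖χ.lin‖ * X := hdat
  have h2 : ‖(χ.withDatum δ).lin B'‖ ≤ ‖χ.lin‖ * χ.α₃ := by
    rw [withDatum_lin]
    exact (χ.lin.le_opNorm B').trans (mul_le_mul_of_nonneg_left hB''.le hlin0)
  calc ‖(τ : ℂ) • (χ.withDatum δ).dat Φ A + (χ.withDatum δ).lin B'‖
      ≤ ‖(τ : ℂ) • (χ.withDatum δ).dat Φ A‖ + ‖(χ.withDatum δ).lin B'‖ := norm_add_le _ _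
    _ ≤ ‖χ.lin‖ * X + ‖χ.lin‖ * χ.α₃ := add_le_add h1 h2
    _ = ‖χ.lin‖ * (X + χ.α₃) := by ring
    _ < χ.a := ha

/-- **THE CHART LAWS OF MODULE D AT A PRESENTED RUN = the run's thirteen datum-free laws + the displayed (3.27)-type law + the constant arithmetic**: the fields
`regime … ev_gc, h337, h345, h350` of `ChartB12Laws` do not mention the datum (they are stated here for `χ`; `χ.withDatum δ` has the same scheme, presentation,
`H_{1,j}`, constants), and the two datum sizes are `dat_lt_withDatum ∕ dat_lin_lt_withDatum`.  Hence module D's `ChartB12Inputs.toFundamental ∕ leaf_of_chart ∕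
package_of_chart` apply to `χ.withDatum δ` BY NAME.  BY REFERENCE (nothing of [15] is proved).
[cite: Balaban1987RG1, (3.27) p.275, (3.30)–(3.32) pp.276–277, (3.37) p.277, (3.45) p.279, (3.50) pp.279–280] [cite: Balaban1985Variational, Prop. 6 p.295, (176)–(177) p.306, Prop. 9 p.309] -/
theorem chartB12Laws_withDatum {Rz : Sect2.Residual P (MatA N)} {cB α' : ℝ}
    (regime : Regime χ.𝒢 0 χ.W χ.B₀ χ.θ χ.C₄ χ.a₃ χ.jc χ.a χ.ε₄) (jc_nonneg : 0 ≤ χ.jc) (T_zero : χ.T 0 = 0) (Klip_pos : 0 < χ.Klip)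
    (lip : ∀ x y : 𝒴, ‖x‖ < χ.ε₄ + χ.a → ‖y‖ < χ.ε₄ + χ.a → ‖χ.T x - χ.T y‖ ≤ χ.Klip * ‖x - y‖) (KD_nonneg : 0 ≤ χ.K_D)
    (second : ∀ Y : 𝒴, ‖Y‖ < χ.ε₄ + χ.a → ‖χ.T Y - Y‖ ≤ χ.K_D * ‖Y‖ ^ 2)
    (ev_le : ∀ (Y : 𝒴) (b : PBond P 0), ‖χ.ev Y b‖ ≤ ‖Y‖)
    (grad_ev_le : ∀ (Y : 𝒴) (μ ν : Fin P.d) (y : Site P 0), ‖grad (χ.toResid.csX cB).ξ μ (fun z => χ.ev Y ⟨z, ν⟩) y‖ ≤ ‖Y‖)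
    (ev_gc : ∀ (Y : 𝒴) (b : PBond P 0), χ.ev Y b ∈ (suModel N).gc)
    (h337 : χ.Klip * (χ.ε₄ + χ.a) ≤ χ.toResid.consts.B₃ ^ 2 * χ.toResid.consts.O₁ * χ.toResid.consts.M * χ.toResid.consts.α₀ *
      (χ.toResid.consts.L ^ (χ.toResid.idx.j - 1) * χ.toResid.idx.η))
    (h345 : 2 * (χ.K_D + χ.B₀ * χ.C₄) * (χ.ε₄ + χ.a) ^ 2 < χ.toResid.consts.B₃ *
      (χ.toResid.consts.B₃ * χ.toResid.consts.O₁ * χ.toResid.consts.M * χ.toResid.consts.α₀ * (χ.toResid.consts.L ^ (χ.toResid.idx.j - 1) * χ.toResid.idx.η)) ^ 2)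
    (h350 : χ.Klip * ((χ.θ + 4 * χ.B₀ * χ.C₄ * (χ.ε₄ + χ.a)) / (1 - (χ.θ + 4 * χ.B₀ * χ.C₄ * (χ.ε₄ + χ.a))) + 1) * ‖χ.lin‖ ≤ χ.toResid.consts.B₃)
    (hη : 0 < χ.idx.η) (h0 : 0 ≤ χ.α₂ + α')
    (hh : ∀ Φ : FieldPair P 0 (MatA N)ˣ (MatA N),
      Φ ∈ space (suModel N) (χ.toResid.frameBox Rz) (χ.toResid.csBox cB) ((1 + 2 * χ.toResid.consts.β) * χ.toResid.consts.α₀)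
          ((1 + 2 * χ.toResid.consts.β) * χ.toResid.consts.α₁) χ.toResid.α₀ →
        ∀ b ∈ (χ.idx.regionT 5).bonds, ‖δ.hBox Φ b‖ < α')
    (hsmall : χ.idx.η * (χ.α₂ + α') ≤ 1 / 8) (ha : ‖χ.lin‖ * (‖δ.Q‖ * (χ.idx.η * (2 * (χ.α₂ + α')))) < χ.a)
    (ha' : ‖χ.lin‖ * (‖δ.Q‖ * (χ.idx.η * (2 * (χ.α₂ + α'))) + χ.α₃) < χ.a) :
    ChartB12Laws Rz cB (χ.withDatum δ) :=
  ⟨regime, jc_nonneg, T_zero, Klip_pos, lip, KD_nonneg, second, ev_le, grad_ev_le, ev_gc,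
    χ.dat_lt_withDatum δ hη h0 hh hsmall ha, χ.dat_lin_lt_withDatum δ hη h0 hh hsmall ha', h337, h345, h350⟩

/-- **The `0 ∈ (3.31)` horn of module D's `provisos_of_chart` is DISCHARGED at a presented run**: inputs + laws + «all the restrictions» give module A's provisos.
NOT a discharge of N09 (the inputs and the laws are hypotheses). [cite: Balaban1987RG1, Lemma 4 (3.53) p.280; (3.31) p.276] -/
theorem provisos_of_chart_withDatum {Rz : Sect2.Residual P (MatA N)} {cB : ℝ} [CompleteSpace 𝒴] (h : ChartB12Inputs Rz cB (χ.withDatum δ))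
    (laws : ChartB12Laws Rz cB (χ.withDatum δ)) (hr : B12Sec2to5.Lemma4Restrictions (χ.withDatum δ).toResid.consts) :
    B12Provisos Rz cB (χ.withDatum δ).toResid :=
  h.provisos_of_chart laws hr (χ.zero_mem_A331_withDatum_of_restrictions δ hr)

end ChartB12Run

end WithDatum

end Literature.MathematicalPhysics.QuantumFieldTheory.Balaban1983to89.Node00
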